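import Literature.IUT.HodgeTheaters.BadLocalFrobenioidOfKits
import HarnessLib

/-!
# [IUTchI] Example 3.2 (v) at `BadLocalFrobenioid.ofKits`: `C⊢_v ⥲ C^Θ_v` maps the ORBIT `τ⊢_v` to the ORBIT `τ^Θ_v`
# member by member on the constant roots of unity (proof-only)

Mochizuki, *Inter-universal Teichmüller Theory I*, kurims manuscript (May 2020), Example 3.2 (iv)–(v) pp. 71–73
[cite: Mochizuki2012, I Ex 3.2 (iv)(v) pp.71-73]: (iv) "`q̲_v` determines a `μ_{2l}(−)`-orbit of characteristic
splittings `τ⊢_v` on `C⊢_v`"; (v) "`C^Θ_v` … equipped with a `μ_{2l}(−)`-orbit of characteristic splittings `τ^Θ_v`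
… we have a natural equivalence of categories `C⊢_v ⥲ C^Θ_v` that maps `τ⊢_v` to `τ^Θ_v`" (compatible with
"`q̲_v|_{T_A} ↦ Θ̲_v|_{T_{A^Θ}}`" and "`𝒪^×(T_A) ⥲ 𝒪^×(T_{A^Θ})`"). (D-0012 claim key, status disputed; nothing of the
series is asserted.)

PROOF-ONLY companion of `BadLocalFrobenioidOfKits.lean` (abc-iut-L5-t2). There the interface field `dashThetaEquiv_tau`
records the RECORDED members (`τ(q̲_v) ↦ τ^Θ(Θ̲_v)`). Here, for the assembly `ofKits` over a tempered-side input `K`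
whose constants map `ι : 𝒪^×_{K_v} → 𝒪^×(T^÷_{Ÿ_v})` (`K.constUnits`) is INJECTIVE (as it is for the genuine objects:
constants embed in the units of the function field):
* `constUnits_mul_theta_injective`, `tauThetaOf_constUnits_mul` — the `Θ`-side splitting attached to `ι(u)·Θ̲_v` IS `τ(u·q̲_v)` (the choice in the
  definition of `TemperedThetaInput.tauThetaOf` is resolved by injectivity);
* **`tauDashOf_mul_isPreservedBy`** — `C⊢_v ⥲ C^Θ_v` maps `τ⊢(u·q̲_v)` to `τ^Θ(ι(u)·Θ̲_v)` for EVERY constant unit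
  `u` (abc-iut-L5-t2's `dashThetaEquiv_tau` for the associate `u·q̲_v`); in particular, for `u = ζ` a `2l`-th root of
  unity, the member `τ⊢(ζ·q̲_v) ∈ τ⊢_v` (`tauDashOf_mul_mem_tauDashOrbit`) goes to the member `τ^Θ(ι(ζ)·Θ̲_v) ∈ τ^Θ_v`
  (`tauThetaOf_mul_mem_tauThetaOrbit`) — the ORBIT statement of (v) on the constant `2l`-th roots of unity
  (print: `μ_{2l}(T^÷_{Ÿ_v})` = the `2l`-th roots of unity of `K_v`, the base field of `Ÿ_v`).
-/

noncomputable section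

namespace Literature.IUT.HodgeTheaters

open CategoryTheory Literature.AnabelianGeometry.SemiGraphs Literature.AlgebraicGeometry.Frobenioids
open Literature.AlgebraicGeometry.Frobenioids.PadicFrd

namespace TemperedThetaInput

variable {p : ℕ} [Fact p.Prime] {d : GaloisValDatum.{0} p} {P : Type} [Group P] [TopologicalSpace P]
  {T : BadLocalGroupDatum d.Gal P} {qroot : intNonzero d.k} {hq : ¬ IsUnit qroot}
  {Fv : Type} [Category.{0} Fv] {Fbirat : Type} [Category.{0} Fbirat] {Cv : Type} [Category.{0} Cv]
  (K : TemperedThetaInput d T hq Fv Fbirat Cv) (hinj : Function.Injective K.constUnits)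

include hinj in
/-- With injective constants, `ι(u)·Θ̲_v = ι(u')·Θ̲_v` forces `u = u'`. [cite: Mochizuki2012, I Ex 3.2 (v) p.72] -/
theorem constUnits_mul_theta_injective :
    Function.Injective fun u : (intNonzero d.k)ˣ => ((K.constUnits u : K.unitsTY) : Aut (K.birat.obj (K.Tobj T.ydd))) * K.theta :=
  fun _ _ h =>
  hinj (Subtype.ext (mul_right_cancel h))

include hinj in
/-- **The `Θ`-side splitting attached to `ι(u)·Θ̲_v` is `τ(u·q̲_v)`** (constants injective).
[cite: Mochizuki2012, I Ex 3.2 (v) p.72] -/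
theorem tauThetaOf_constUnits_mul (u : (intNonzero d.k)ˣ) :
    K.tauThetaOf (((K.constUnits u : K.unitsTY) : Aut (K.birat.obj (K.Tobj T.ydd))) * K.theta) = T.tauThetaOf d hq (((u : (intNonzero d.k)ˣ) : intNonzero d.k) * qroot) := by
  unfold tauThetaOf
  by_cases h1 : (((K.constUnits u : K.unitsTY) : Aut (K.birat.obj (K.Tobj T.ydd))) * K.theta) = K.theta
  · have hu : u = 1 := K.constUnits_mul_theta_injective hinj (h1.trans (by
      change K.theta = ((K.constUnits 1 : K.unitsTY) : Aut (K.birat.obj (K.Tobj T.ydd))) * K.theta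
      rw [map_one, OneMemClass.coe_one, one_mul]))
    subst hu
    rw [if_pos h1, Units.val_one, one_mul]
  · have hex : ∃ u' : (intNonzero d.k)ˣ,
        ((K.constUnits u' : K.unitsTY) : Aut (K.birat.obj (K.Tobj T.ydd))) * K.theta =
          (((K.constUnits u : K.unitsTY) : Aut (K.birat.obj (K.Tobj T.ydd))) * K.theta) := ⟨u, rfl⟩
    rw [if_neg h1, dif_pos hex, K.constUnits_mul_theta_injective hinj (Classical.choose_spec hex)]

include hinj in
/-- **`C⊢_v ⥲ C^Θ_v` maps `τ⊢(u·q̲_v)` to `τ^Θ(ι(u)·Θ̲_v)`** for every constant unit `u` (constants injective).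
[cite: Mochizuki2012, I Ex 3.2 (v) p.73] -/
theorem tauDashOf_mul_isPreservedBy (u : (intNonzero d.k)ˣ) :
    (d.tauDashOf hq (((u : (intNonzero d.k)ˣ) : intNonzero d.k) * qroot)).IsPreservedBy
      (K.tauThetaOf (((K.constUnits u : K.unitsTY) : Aut (K.birat.obj (K.Tobj T.ydd))) * K.theta)) (T.dashThetaEquiv d hq).functor := by
  rw [K.tauThetaOf_constUnits_mul hinj u]
  exact T.dashThetaEquiv_tau d hq _ (associated_unit_mul_left _ _ (Units.isUnit u))

end TemperedThetaInput

namespace BadLocalFrobenioid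

variable {p : ℕ} [Fact p.Prime] (l : ℕ) (d : GaloisValDatum.{0} p) {P : Type} [Group P] [TopologicalSpace P]
  (T : BadLocalGroupDatum d.Gal P) (q qroot : intNonzero d.k) (hpow : qroot ^ (2 * l) = q) (hq : ¬ IsUnit qroot)
  {Fv : Type} [Category.{0} Fv] {Fbirat : Type} [Category.{0} Fbirat] {Cv : Type} [Category.{0} Cv]
  (K : TemperedThetaInput d T hq Fv Fbirat Cv)

/-- For a `2l`-th root of unity `ζ ∈ 𝒪^×_{K_v}`, `τ⊢(ζ·q̲_v)` is a member of the orbit `τ⊢_v` of `ofKits`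
(`(ζ·q̲_v)^{2l} = q_v`). [cite: Mochizuki2012, I Ex 3.2 (iv) p.71] -/
theorem tauDashOf_mul_mem_tauDashOrbit (ζ : (intNonzero d.k)ˣ) (hζ : ζ ^ (2 * l) = 1) :
    d.tauDashOf hq (((ζ : (intNonzero d.k)ˣ) : intNonzero d.k) * qroot) ∈ (ofKits l d T q qroot hpow hq K).tauDashOrbit :=
  ⟨((ζ : (intNonzero d.k)ˣ) : intNonzero d.k) * qroot, by
    change (((ζ : (intNonzero d.k)ˣ) : intNonzero d.k) * qroot) ^ (2 * l) = q
    rw [mul_pow, ← Units.val_pow_eq_pow_val, hζ, Units.val_one, one_mul, hpow], rfl⟩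

/-- For a `2l`-th root of unity `ζ ∈ 𝒪^×_{K_v}`, `τ^Θ(ι(ζ)·Θ̲_v)` is a member of the orbit `τ^Θ_v` of `ofKits`
(`ι(ζ) ∈ μ_{2l}(T^÷_{Ÿ_v})`). [cite: Mochizuki2012, I Ex 3.2 (v) p.72] -/
theorem tauThetaOf_mul_mem_tauThetaOrbit (ζ : (intNonzero d.k)ˣ) (hζ : ζ ^ (2 * l) = 1) :
    K.tauThetaOf (((K.constUnits ζ : K.unitsTY) : Aut (K.birat.obj (K.Tobj T.ydd))) * K.theta) ∈
      (ofKits l d T q qroot hpow hq K).tauThetaOrbit :=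
  ⟨((K.constUnits ζ : K.unitsTY) : Aut (K.birat.obj (K.Tobj T.ydd))),
    ⟨(K.constUnits ζ).2, by
      have h : (((K.constUnits ζ ^ (2 * l) : K.unitsTY)) : Aut (K.birat.obj (K.Tobj T.ydd))) =
          ((1 : K.unitsTY) : Aut (K.birat.obj (K.Tobj T.ydd))) := by
        rw [← map_pow, hζ, map_one]
      rw [Subgroup.coe_pow, OneMemClass.coe_one] at h
      exact h⟩, rfl⟩

/-- **Ex. 3.2 (v), ORBIT form, at `ofKits` with injective constants**: for every `2l`-th root of unity `ζ ∈ 𝒪^×_{K_v}`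
the member `τ⊢(ζ·q̲_v)` of `τ⊢_v` is carried by `C⊢_v ⥲ C^Θ_v` onto the member `τ^Θ(ι(ζ)·Θ̲_v)` of `τ^Θ_v`.
[cite: Mochizuki2012, I Ex 3.2 (v) p.73] -/
theorem tauDashOrbit_isPreservedBy (hinj : Function.Injective K.constUnits) (ζ : (intNonzero d.k)ˣ)
    (hζ : ζ ^ (2 * l) = 1) :
    ∃ τ ∈ (ofKits l d T q qroot hpow hq K).tauDashOrbit, ∃ τ' ∈ (ofKits l d T q qroot hpow hq K).tauThetaOrbit,
      τ = d.tauDashOf hq (((ζ : (intNonzero d.k)ˣ) : intNonzero d.k) * qroot) ∧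
        S3Local.CharSplitting.IsPreservedBy τ τ' (ofKits l d T q qroot hpow hq K).dashThetaEquiv.functor :=
  ⟨_, tauDashOf_mul_mem_tauDashOrbit l d T q qroot hpow hq K ζ hζ, _,
    tauThetaOf_mul_mem_tauThetaOrbit l d T q qroot hpow hq K ζ hζ, rfl, K.tauDashOf_mul_isPreservedBy hinj ζ⟩

end BadLocalFrobenioid

end Literature.IUT.HodgeTheaters

end
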